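import Summits.Ventures.PercRepro.HJoin
import Summits.Ventures.PercRepro.ConnInDecidable
import Summits.Ventures.PercRepro.Decide

/-!
# Within-part H-steps, H-walks and H-chains are decidable on finite types

With `Decide`'s decidable connectivity (cluster membership) and `ConnInDecidable`'s decidable
within-part connectivity, a within-part H-step `HAdjIn` is decidable; the within-part H-walk
avoiding `X` is reachability of a symmetric decidable relation (`hConnAvoidIn_iff_reachable`), so
it is decidable, and so are the H-join step and the H-chain (`hchain_iff_reachable`).  Hence the
per-part H-profiles of a concrete gadget, and the type of a concrete gluing, are settled by `decide`.
-/

namespace PercRepro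

namespace MultiGraph

variable {V E ι : Type*} {G : MultiGraph V E} [DecidableEq V] [Fintype V] [Fintype E] [DecidableEq ι]

/-- Membership in a cluster is decidable (by `Decide`'s decidable connectivity). -/
instance decidableMemCluster (S : Config E) (c u : V) : Decidable (u ∈ G.cluster S c) :=
  decidable_of_iff (G.Conn S c u) Iff.rfl

/-- `Joins` is decidable. -/
instance decidableJoins (e : E) (u v : V) : Decidable (G.Joins e u v) := by
  unfold Joins
  infer_instance

/-- A within-part H-step is decidable. -/
instance decidableHAdjIn (S : Config E) (c : V) (pe : E → ι) (i : ι) (u v : V) :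
    Decidable (G.HAdjIn S c pe i u v) := by
  unfold HAdjIn
  infer_instance

omit [DecidableEq V] [Fintype V] [Fintype E] [DecidableEq ι] in
/-- A within-part H-walk avoiding `X` is reachability in the graph of within-part H-steps outside
`X`. -/
theorem hConnAvoidIn_iff_reachable (S : Config E) (c : V) (pe : E → ι) (i : ι) (X : Set V)
    (u v : V) :
    G.HConnAvoidIn S c pe i X u v ↔
      (SimpleGraph.fromRel fun x y => G.HAdjIn S c pe i x y ∧ x ∉ X ∧ y ∉ X).Reachable u v :=
  reflTransGen_iff_reachable_fromRel (fun _ _ h => ⟨h.1.symm, h.2.2, h.2.1⟩) u v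

/-- A within-part H-walk avoiding a decidable set is decidable. -/
instance decidableHConnAvoidIn (S : Config E) (c : V) (pe : E → ι) (i : ι) (X : Set V)
    [DecidablePred (· ∈ X)] (u v : V) : Decidable (G.HConnAvoidIn S c pe i X u v) :=
  decidable_of_iff _ (G.hConnAvoidIn_iff_reachable S c pe i X u v).symm

/-- An H-join step is decidable. -/
instance decidableHJoinStep [Fintype ι] (S : Config E) (c : V) (pe : E → ι) (Cen X : Set V)
    [DecidablePred (· ∈ Cen)] [DecidablePred (· ∈ X)] (t t' : V) :
    Decidable (G.HJoinStep S c pe Cen X t t') := by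
  unfold HJoinStep
  infer_instance

omit [DecidableEq V] [Fintype V] [Fintype E] [DecidableEq ι] in
/-- The H-chain is reachability in the graph of H-join steps. -/
theorem hchain_iff_reachable (S : Config E) (c : V) (pe : E → ι) (Cen X : Set V) (u v : V) :
    Relation.ReflTransGen (G.HJoinStep S c pe Cen X) u v ↔
      (SimpleGraph.fromRel (G.HJoinStep S c pe Cen X)).Reachable u v :=
  reflTransGen_iff_reachable_fromRel (fun _ _ h => h.symm) u v

/-- The H-chain is decidable. -/
instance decidableHChain [Fintype ι] (S : Config E) (c : V) (pe : E → ι) (Cen X : Set V)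
    [DecidablePred (· ∈ Cen)] [DecidablePred (· ∈ X)] (u v : V) :
    Decidable (Relation.ReflTransGen (G.HJoinStep S c pe Cen X) u v) :=
  decidable_of_iff _ (G.hchain_iff_reachable S c pe Cen X u v).symm

end MultiGraph

end PercRepro
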